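import Mathlib
import Literature.MathematicalPhysics.QuantumFieldTheory.OSHolomorphicVectors
import HarnessLib

/-!
# Holomorphic vectors from a sesqui-holomorphic Gram kernel on a strip — stub `stub_gramVecOnStrip`

Line `boosts-inherit-mirrors` of crux `MirrorModularBoosts.CurvatureBoostCovariance`
(stmt-QuantumFields-9663), Stub 4a-i of the registered skeleton
`Cruxes/CurvatureBoostCovariance/Lines/boosts_inherit_mirrors.lean` (reshape 6): the abstract
Hilbert-space half of the boosted OS vectors `V(θ) = Ψ_{R_θ F}` (the scalar half, Stub 4a-ii
`stub_doubledOrbitKernel`, supplies the Gram kernel; the skeleton combines the two into Stub 4a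
`stub_uniformPlanarBoostVectors`).

Statement (`stub_gramVecOnStrip`; pure Hilbert-space complex analysis, model-blind).  Let `H` be
a complex Hilbert space, `ε > 0`, `S = {z ∈ ℂ | |Re z| < ε}` the vertical strip, `Φ : ℝ → H` and
`K : ℂ → ℂ → ℂ` with `uncurry K` holomorphic on `S × S` and `⟪Φ η', Φ η⟫ = K(η', η)` for real
`|η|, |η'| < ε`.  Then there is `Ψ : ℂ → H`, holomorphic on `S`, with `Ψ η = Φ η` for real
`|η| < ε` and `⟪Ψ w, Ψ z⟫ = K(w̄, z)` for all `w, z ∈ S`.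

Proof.  The tree proves the polydisc version, `exists_holomorphic_gramVec_polydisc`
(`Literature/MathematicalPhysics/QuantumFieldTheory/OSHolomorphicVectors.lean`; Osterwalder–Schrader
II, Ch. V.2, (5.16)–(5.21), by the reproducing-kernel route): on a real-centred polydisc `P ⊆ ℂᵐ`,
a kernel `k` jointly holomorphic on `P × P` which is the Gram kernel of vectors `Φ̃` at the real
points of `P` yields `Ψ̃` holomorphic on `P`, equal to `Φ̃` at the real points, with the continued
Gram identity `⟪Ψ̃ w, Ψ̃ z⟫ = k(w̄, z)` on `P`.  The strip is not a real-centred polydisc, so we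
TRANSPORT along the biholomorphism (`a = π/(4ε)`)

  `Ξ(z) = tan(a z) : S → D = {|u| < 1}`,   `Λ(u) = a⁻¹ arctan u : D → S`,

of the strip onto the open unit disc `D`, which is the polydisc of `ℂ¹` with centre `0` and radius
`1`.  The needed facts (namespace `GramVecOnStrip`, stated for a scale `a > 0` with `a ε = π/4`):
`Ξ(S) ⊆ D`, from the identity `‖cos w‖² - ‖sin w‖² = cos(2 Re w)`
(`= cos w cos w̄ - sin w sin w̄ = cos(w + w̄)`), positive for `|Re w| < π/4`; `Λ(D) ⊆ S`, from
`Re arctan u = ½ arg((1 + iu)/(1 - iu))` and `Re((1 + iu)/(1 - iu)) = (1 - |u|²)/|1 - iu|² > 0` on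
`D`; holomorphy of `Ξ` on `S` (`cos ≠ 0` there) and of `Λ` on `D`
(`Complex.arctan u = -(i/2) log((1 + iu)/(1 - iu))`, the Cayley quotient lying in the slit plane);
`Λ ∘ Ξ = id` on `S` (`Complex.arctan_tan`); both maps are real on real points
(`Complex.ofReal_tan`, `Complex.ofReal_arctan`); and `Ξ(z̄) = conj Ξ(z)` (`Complex.tan_conj`).
With `k(u, v) = K(Λ u₀, Λ v₀)` (holomorphic on `D × D` as a composite into `S × S`) and
`Φ̃(t) = Φ(a⁻¹ arctan t₀)`, whose Gram kernel at real points is `k` because `Λ` is real there,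
the polydisc theorem gives `Ψ̃` on `D`; then `Ψ(z) = Ψ̃(Ξ z)` is holomorphic on `S`,
`Ψ(η) = Φ̃(tan(a η)) = Φ(a⁻¹ arctan tan(a η)) = Φ(η)` (`Real.arctan_tan`), and
`⟪Ψ w, Ψ z⟫ = k(conj Ξ w, Ξ z) = K(Λ Ξ w̄, Λ Ξ z) = K(w̄, z)`.

References: K. Osterwalder, R. Schrader, *Axioms for Euclidean Green's functions II*, Comm. Math.
Phys. 42 (1975), Ch. V.2 (5.16)–(5.21) (holomorphic vectors from the continued Gram kernel);
the conformal map `tan` of the strip `|Re w| < π/4` onto the unit disc is classical.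
-/

noncomputable section

namespace Summit.QuantumFields.YangMills.Theorems.CurvatureBoostCovariance.BoostsInheritMirrors

open scoped InnerProductSpace ComplexConjugate Real
open Set Metric
open Literature.Analysis.Complex Literature.MathematicalPhysics.QuantumFieldTheory

namespace GramVecOnStrip

/-! ## `tan` maps the strip `{|Re w| < π/4}` into the unit disc -/

/-- **`‖cos w‖² - ‖sin w‖² = cos (2 Re w)`** (from `cos w · cos w̄ - sin w · sin w̄ = cos (w + w̄)`). -/
theorem normSq_cos_sub_normSq_sin (w : ℂ) :
    Complex.normSq (Complex.cos w) - Complex.normSq (Complex.sin w) = Real.cos (2 * w.re) := by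
  have h : (Complex.normSq (Complex.cos w) : ℂ) - Complex.normSq (Complex.sin w) =
      (Real.cos (2 * w.re) : ℂ) := by
    rw [← Complex.mul_conj, ← Complex.mul_conj, ← Complex.cos_conj, ← Complex.sin_conj,
      ← Complex.cos_add, Complex.add_conj, Complex.ofReal_cos]
  exact_mod_cast h

/-- On the strip `|Re w| < π/4`: `cos w ≠ 0` and **`‖tan w‖ < 1`**. -/
theorem cos_ne_zero_and_norm_tan_lt_one {w : ℂ} (hw : |w.re| < π / 4) :
    Complex.cos w ≠ 0 ∧ ‖Complex.tan w‖ < 1 := by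
  have hcos : 0 < Real.cos (2 * w.re) :=
    Real.cos_pos_of_mem_Ioo ⟨by linarith [(abs_lt.1 hw).1], by linarith [(abs_lt.1 hw).2]⟩
  have h := normSq_cos_sub_normSq_sin w
  have hlt : Complex.normSq (Complex.sin w) < Complex.normSq (Complex.cos w) := by linarith
  have hcos0 : Complex.cos w ≠ 0 := by
    intro h0
    rw [h0, map_zero] at hlt
    exact absurd hlt (not_lt.2 (Complex.normSq_nonneg _))
  refine ⟨hcos0, ?_⟩
  rw [Complex.normSq_eq_norm_sq, Complex.normSq_eq_norm_sq] at hlt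
  rw [Complex.tan_eq_sin_div_cos, norm_div, div_lt_one (norm_pos_iff.2 hcos0)]
  exact lt_of_pow_lt_pow_left₀ 2 (norm_nonneg _) hlt

/-! ## `arctan` on the unit disc -/

/-- For `‖u‖ < 1`, `1 - u I ≠ 0`. -/
theorem one_sub_mul_I_ne_zero {u : ℂ} (hu : ‖u‖ < 1) : 1 - u * Complex.I ≠ 0 := by
  intro h
  have h1 := congrArg norm (sub_eq_zero.1 h)
  rw [norm_one, norm_mul, Complex.norm_I, mul_one] at h1
  linarith

/-- For `‖u‖ < 1` the Cayley quotient `(1 + u I)/(1 - u I)` has **positive real part**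
`(1 - ‖u‖²)/‖1 - u I‖²`. -/
theorem cayley_re_pos {u : ℂ} (hu : ‖u‖ < 1) :
    0 < ((1 + u * Complex.I) / (1 - u * Complex.I)).re := by
  have hns : 0 < Complex.normSq (1 - u * Complex.I) :=
    Complex.normSq_pos.2 (one_sub_mul_I_ne_zero hu)
  have hu2 : u.re * u.re + u.im * u.im < 1 := by
    rw [← Complex.normSq_apply, Complex.normSq_eq_norm_sq]
    nlinarith [norm_nonneg u]
  have e1 : (1 + u * Complex.I).re = 1 + -u.im := by simp
  have e2 : (1 + u * Complex.I).im = u.re := by simp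
  have e3 : (1 - u * Complex.I).re = 1 + u.im := by simp
  have e4 : (1 - u * Complex.I).im = -u.re := by simp
  rw [Complex.div_re, ← add_div, e1, e2, e3, e4]
  exact div_pos (by nlinarith) hns

/-- `Re (arctan u) = ½ arg ((1 + u I)/(1 - u I))`, hence **`|Re (arctan u)| < π/4`** on the unit
disc. -/
theorem abs_re_arctan_lt {u : ℂ} (hu : ‖u‖ < 1) : |(Complex.arctan u).re| < π / 4 := by
  have harg : |Complex.arg ((1 + u * Complex.I) / (1 - u * Complex.I))| < π / 2 :=
    Complex.abs_arg_lt_pi_div_two_iff.2 (Or.inl (cayley_re_pos hu))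
  have hre : (Complex.arctan u).re =
      Complex.arg ((1 + u * Complex.I) / (1 - u * Complex.I)) / 2 := by
    rw [Complex.arctan, Complex.mul_re, Complex.log_im]
    simp only [Complex.div_ofNat_re, Complex.div_ofNat_im, Complex.neg_re, Complex.neg_im,
      Complex.I_re, Complex.I_im, neg_zero, zero_div]
    ring
  rw [hre, abs_div, abs_two]
  linarith

/-- **`arctan` is complex-differentiable on the unit disc** (the Cayley quotient lies in the slit
plane, where `log` is holomorphic). -/
theorem differentiableAt_arctan {u : ℂ} (hu : ‖u‖ < 1) :
    DifferentiableAt ℂ Complex.arctan u := by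
  have hslit : (1 + u * Complex.I) / (1 - u * Complex.I) ∈ Complex.slitPlane :=
    Complex.mem_slitPlane_iff.2 (Or.inl (cayley_re_pos hu))
  have hq : DifferentiableAt ℂ (fun z : ℂ => (1 + z * Complex.I) / (1 - z * Complex.I)) u :=
    ((differentiableAt_const _).add (differentiableAt_id.mul_const _)).div
      ((differentiableAt_const _).sub (differentiableAt_id.mul_const _)) (one_sub_mul_I_ne_zero hu)
  have heq : Complex.arctan =
      fun z : ℂ => -Complex.I / 2 * Complex.log ((1 + z * Complex.I) / (1 - z * Complex.I)) := rfl
  rw [heq]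
  exact (hq.clog hslit).const_mul _

/-! ## The scaled maps `Ξ = tan (a ·)` (strip → disc) and `Λ = a⁻¹ arctan` (disc → strip), `a ε = π/4` -/

variable {a ε : ℝ}

/-- `|Re (a z)| < π/4` on the strip `{|Re z| < ε}` (`a > 0`, `a ε = π/4`). -/
theorem abs_re_mul_lt (ha : 0 < a) (haε : a * ε = π / 4) {z : ℂ} (hz : |z.re| < ε) :
    |((a : ℂ) * z).re| < π / 4 := by
  rw [Complex.re_ofReal_mul, abs_mul, abs_of_pos ha, ← haε]
  exact mul_lt_mul_of_pos_left hz ha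

/-- **`Ξ = tan (a ·)` maps the strip into the unit disc.** -/
theorem norm_tan_mul_lt_one (ha : 0 < a) (haε : a * ε = π / 4) {z : ℂ} (hz : |z.re| < ε) :
    ‖Complex.tan ((a : ℂ) * z)‖ < 1 :=
  (cos_ne_zero_and_norm_tan_lt_one (abs_re_mul_lt ha haε hz)).2

/-- **`Ξ = tan (a ·)` is holomorphic on the strip.** -/
theorem differentiableAt_tan_mul (ha : 0 < a) (haε : a * ε = π / 4) {z : ℂ} (hz : |z.re| < ε) :
    DifferentiableAt ℂ (fun z : ℂ => Complex.tan ((a : ℂ) * z)) z :=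
  (Complex.differentiableAt_tan.2 (cos_ne_zero_and_norm_tan_lt_one (abs_re_mul_lt ha haε hz)).1).comp
    z (differentiableAt_id.const_mul _)

/-- `Ξ = tan (a ·)` commutes with complex conjugation. -/
theorem tan_mul_conj (a : ℝ) (z : ℂ) :
    Complex.tan ((a : ℂ) * conj z) = conj (Complex.tan ((a : ℂ) * z)) := by
  rw [← Complex.tan_conj, map_mul, Complex.conj_ofReal]

/-- `Ξ = tan (a ·)` is real on the real axis. -/
theorem tan_mul_ofReal (a η : ℝ) : Complex.tan ((a : ℂ) * η) = (Real.tan (a * η) : ℝ) := by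
  rw [Complex.ofReal_tan, Complex.ofReal_mul]

/-- `Λ = a⁻¹ arctan` is real on the real axis. -/
theorem inv_mul_arctan_ofReal (a t : ℝ) :
    ((a⁻¹ : ℝ) : ℂ) * Complex.arctan t = ((a⁻¹ * Real.arctan t : ℝ) : ℂ) := by
  rw [Complex.ofReal_mul, Complex.ofReal_arctan]

/-- **`Λ = a⁻¹ arctan` maps the unit disc into the strip.** -/
theorem abs_re_inv_mul_arctan_lt (ha : 0 < a) (haε : a * ε = π / 4) {u : ℂ} (hu : ‖u‖ < 1) :
    |(((a⁻¹ : ℝ) : ℂ) * Complex.arctan u).re| < ε := by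
  rw [Complex.re_ofReal_mul, abs_mul, abs_of_pos (inv_pos.2 ha)]
  calc a⁻¹ * |(Complex.arctan u).re| < a⁻¹ * (π / 4) :=
        mul_lt_mul_of_pos_left (abs_re_arctan_lt hu) (inv_pos.2 ha)
    _ = ε := by rw [← haε, inv_mul_cancel_left₀ ha.ne']

/-- **`Λ = a⁻¹ arctan` is holomorphic on the unit disc.** -/
theorem differentiableAt_inv_mul_arctan (a : ℝ) {u : ℂ} (hu : ‖u‖ < 1) :
    DifferentiableAt ℂ (fun u : ℂ => ((a⁻¹ : ℝ) : ℂ) * Complex.arctan u) u :=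
  (differentiableAt_arctan hu).const_mul _

/-- **`Λ ∘ Ξ = id` on the strip** (`Complex.arctan_tan`). -/
theorem inv_mul_arctan_tan_mul (ha : 0 < a) (haε : a * ε = π / 4) {z : ℂ} (hz : |z.re| < ε) :
    ((a⁻¹ : ℝ) : ℂ) * Complex.arctan (Complex.tan ((a : ℂ) * z)) = z := by
  have hlt := abs_re_mul_lt ha haε hz
  have h1 : -(π / 2) < ((a : ℂ) * z).re := by linarith [(abs_lt.1 hlt).1, Real.pi_pos]
  have h2 : ((a : ℂ) * z).re ≤ π / 2 := by linarith [(abs_lt.1 hlt).2, Real.pi_pos]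
  have h0 : (a : ℂ) * z ≠ π / 2 := by
    intro h
    have h' := congrArg Complex.re h
    have hre : ((π : ℂ) / 2).re = π / 2 := by simp
    rw [hre] at h'
    linarith [(abs_lt.1 hlt).2, Real.pi_pos]
  rw [Complex.arctan_tan h0 h1 h2, ← mul_assoc, ← Complex.ofReal_mul, inv_mul_cancel₀ ha.ne',
    Complex.ofReal_one, one_mul]

/-- The unit disc of `ℂ¹` as the real-centred polydisc with centre `0` and radius `1`: membership. -/
theorem mem_unitPolydisc {u : Fin 1 → ℂ} :
    u ∈ polydisc (fun _ : Fin 1 => ((0 : ℝ) : ℂ)) (fun _ => (1 : ℝ)) ↔ ‖u 0‖ < 1 := by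
  rw [mem_polydisc, Fin.forall_fin_one, Complex.ofReal_zero, mem_ball_zero_iff]

end GramVecOnStrip

open GramVecOnStrip in
/-- **Stub 4a-i — holomorphic vectors from a sesqui-holomorphic Gram kernel on a strip.**  If
`K` is jointly holomorphic on the square of the strip `S = {|Re z| < ε}` and is the Gram kernel
`⟪Φ η', Φ η⟫ = K(η', η)` of vectors `Φ η` (`|η| < ε` real) of a complex Hilbert space, then there
is `Ψ` holomorphic on `S` with `Ψ = Φ` at the real points and `⟪Ψ w, Ψ z⟫ = K(w̄, z)` on `S × S`.
Registered signature of the skeleton `Cruxes/CurvatureBoostCovariance/Lines/boosts_inherit_mirrors.lean`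
(reshape 6), verbatim; proof by transport of `exists_holomorphic_gramVec_polydisc` along
`tan (a ·) : S → unit disc`, `a = π/(4ε)`. -/
theorem stub_gramVecOnStrip :
    ∀ (H : Type) [NormedAddCommGroup H] [InnerProductSpace ℂ H] [CompleteSpace H] (ε : ℝ), 0 < ε →
      ∀ (Φ : ℝ → H) (K : ℂ → ℂ → ℂ),
        DifferentiableOn ℂ (Function.uncurry K) ({z : ℂ | |z.re| < ε} ×ˢ {z : ℂ | |z.re| < ε}) →
        (∀ η η' : ℝ, |η| < ε → |η'| < ε → ⟪Φ η', Φ η⟫_ℂ = K η' η) →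
        ∃ Ψ : ℂ → H, DifferentiableOn ℂ Ψ {z : ℂ | |z.re| < ε} ∧
          (∀ η : ℝ, |η| < ε → Ψ η = Φ η) ∧
          ∀ w z : ℂ, |w.re| < ε → |z.re| < ε → ⟪Ψ w, Ψ z⟫_ℂ = K (starRingEnd ℂ w) z := by
  intro H _ _ _ ε hε Φ K hK hGram
  -- the scale `a = π/(4ε)`
  obtain ⟨a, ha, haε⟩ : ∃ a : ℝ, 0 < a ∧ a * ε = π / 4 :=
    ⟨π / (4 * ε), by positivity, by field_simp⟩
  -- the transported kernel and real-point vectors on the unit disc `D` of `ℂ¹`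
  set k : (Fin 1 → ℂ) → (Fin 1 → ℂ) → ℂ := fun u v =>
    K (((a⁻¹ : ℝ) : ℂ) * Complex.arctan (u 0)) (((a⁻¹ : ℝ) : ℂ) * Complex.arctan (v 0)) with hk
  set Φ' : (Fin 1 → ℝ) → H := fun t => Φ (a⁻¹ * Real.arctan (t 0)) with hΦ'
  have hr : ∀ _ : Fin 1, (0 : ℝ) < 1 := fun _ => one_pos
  -- `k` is jointly holomorphic on `D × D`: a composite of `uncurry K` with `Λ × Λ : D × D → S × S`
  have hkd : DifferentiableOn ℂ (Function.uncurry k)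
      (polydisc (fun _ : Fin 1 => ((0 : ℝ) : ℂ)) (fun _ => (1 : ℝ)) ×ˢ
        polydisc (fun _ : Fin 1 => ((0 : ℝ) : ℂ)) (fun _ => (1 : ℝ))) := by
    have hg : DifferentiableOn ℂ
        (fun p : (Fin 1 → ℂ) × (Fin 1 → ℂ) =>
          (((a⁻¹ : ℝ) : ℂ) * Complex.arctan (p.1 0), ((a⁻¹ : ℝ) : ℂ) * Complex.arctan (p.2 0)))
        (polydisc (fun _ : Fin 1 => ((0 : ℝ) : ℂ)) (fun _ => (1 : ℝ)) ×ˢ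
          polydisc (fun _ : Fin 1 => ((0 : ℝ) : ℂ)) (fun _ => (1 : ℝ))) := by
      intro p hp
      have hfst : DifferentiableAt ℂ (fun x : (Fin 1 → ℂ) × (Fin 1 → ℂ) => x.1 0) p :=
        (differentiableAt_apply (𝕜 := ℂ) (0 : Fin 1) p.1).comp p differentiableAt_fst
      have hsnd : DifferentiableAt ℂ (fun x : (Fin 1 → ℂ) × (Fin 1 → ℂ) => x.2 0) p :=
        (differentiableAt_apply (𝕜 := ℂ) (0 : Fin 1) p.2).comp p differentiableAt_snd
      exact (((differentiableAt_inv_mul_arctan a (mem_unitPolydisc.1 hp.1)).comp p hfst).prodMk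
        ((differentiableAt_inv_mul_arctan a (mem_unitPolydisc.1 hp.2)).comp p hsnd)).differentiableWithinAt
    have hmaps : MapsTo
        (fun p : (Fin 1 → ℂ) × (Fin 1 → ℂ) =>
          (((a⁻¹ : ℝ) : ℂ) * Complex.arctan (p.1 0), ((a⁻¹ : ℝ) : ℂ) * Complex.arctan (p.2 0)))
        (polydisc (fun _ : Fin 1 => ((0 : ℝ) : ℂ)) (fun _ => (1 : ℝ)) ×ˢ
          polydisc (fun _ : Fin 1 => ((0 : ℝ) : ℂ)) (fun _ => (1 : ℝ)))
        ({z : ℂ | |z.re| < ε} ×ˢ {z : ℂ | |z.re| < ε}) := fun p hp =>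
      ⟨abs_re_inv_mul_arctan_lt ha haε (mem_unitPolydisc.1 hp.1),
        abs_re_inv_mul_arctan_lt ha haε (mem_unitPolydisc.1 hp.2)⟩
    exact hK.comp hg hmaps
  -- the Gram identity at the real points of `D` (`Λ` is real there)
  have hGram' : ∀ η η' : Fin 1 → ℝ,
      (fun i => (η i : ℂ)) ∈ polydisc (fun _ : Fin 1 => ((0 : ℝ) : ℂ)) (fun _ => (1 : ℝ)) →
      (fun i => (η' i : ℂ)) ∈ polydisc (fun _ : Fin 1 => ((0 : ℝ) : ℂ)) (fun _ => (1 : ℝ)) →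
      ⟪Φ' η', Φ' η⟫_ℂ = k (fun i => (η' i : ℂ)) (fun i => (η i : ℂ)) := by
    intro η η' hη hη'
    have h1 := abs_re_inv_mul_arctan_lt ha haε (mem_unitPolydisc.1 hη)
    have h2 := abs_re_inv_mul_arctan_lt ha haε (mem_unitPolydisc.1 hη')
    show ⟪Φ (a⁻¹ * Real.arctan (η' 0)), Φ (a⁻¹ * Real.arctan (η 0))⟫_ℂ =
      K (((a⁻¹ : ℝ) : ℂ) * Complex.arctan (η' 0)) (((a⁻¹ : ℝ) : ℂ) * Complex.arctan (η 0))
    rw [inv_mul_arctan_ofReal, Complex.ofReal_re] at h1 h2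
    rw [inv_mul_arctan_ofReal, inv_mul_arctan_ofReal]
    exact hGram _ _ h1 h2
  obtain ⟨Ψ', hΨ'd, hΨ'r, -, -, hΨ'g⟩ :=
    exists_holomorphic_gramVec_polydisc (ξ := fun _ : Fin 1 => (0 : ℝ)) (r := fun _ => (1 : ℝ))
      (k := k) (Φ := Φ') hr hkd hGram'
  have hmem : ∀ {z : ℂ}, |z.re| < ε → (fun _ : Fin 1 => Complex.tan ((a : ℂ) * z)) ∈
      polydisc (fun _ : Fin 1 => ((0 : ℝ) : ℂ)) (fun _ => (1 : ℝ)) :=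
    fun hz => mem_unitPolydisc.2 (norm_tan_mul_lt_one ha haε hz)
  refine ⟨fun z => Ψ' (fun _ => Complex.tan ((a : ℂ) * z)), ?_, ?_, ?_⟩
  · -- holomorphy on the strip: `Ψ' ∘ Ξ`
    have hd : DifferentiableOn ℂ (fun z : ℂ => fun _ : Fin 1 => Complex.tan ((a : ℂ) * z))
        {z : ℂ | |z.re| < ε} := fun z hz =>
      (differentiableAt_pi.2 fun _ => differentiableAt_tan_mul ha haε hz).differentiableWithinAt
    exact hΨ'd.comp hd fun z hz => hmem hz
  · -- the real points: `Ξ` is real there and `Λ ∘ Ξ = id`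
    intro η hη
    have hηS : |(η : ℂ).re| < ε := by simpa using hη
    have hηa : |a * η| < π / 4 := by
      have h := abs_re_mul_lt ha haε hηS
      rwa [← Complex.ofReal_mul, Complex.ofReal_re] at h
    have hfun : (fun _ : Fin 1 => Complex.tan ((a : ℂ) * η)) =
        fun _ : Fin 1 => ((Real.tan (a * η) : ℝ) : ℂ) := funext fun _ => tan_mul_ofReal a η
    have hmemη : (fun _ : Fin 1 => ((Real.tan (a * η) : ℝ) : ℂ)) ∈
        polydisc (fun _ : Fin 1 => ((0 : ℝ) : ℂ)) (fun _ => (1 : ℝ)) := hfun ▸ hmem hηS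
    show Ψ' (fun _ => Complex.tan ((a : ℂ) * η)) = Φ η
    rw [hfun, hΨ'r (fun _ => Real.tan (a * η)) hmemη]
    show Φ (a⁻¹ * Real.arctan (Real.tan (a * η))) = Φ η
    rw [Real.arctan_tan (by linarith [(abs_lt.1 hηa).1, Real.pi_pos])
      (by linarith [(abs_lt.1 hηa).2, Real.pi_pos]), inv_mul_cancel_left₀ ha.ne']
  · -- the Gram identity: `k(conj Ξ w, Ξ z) = K(Λ Ξ w̄, Λ Ξ z) = K(w̄, z)`
    intro w z hw hz
    have hw' : |(conj w).re| < ε := by rwa [Complex.conj_re]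
    show ⟪Ψ' (fun _ => Complex.tan ((a : ℂ) * w)), Ψ' (fun _ => Complex.tan ((a : ℂ) * z))⟫_ℂ =
      K (conj w) z
    rw [hΨ'g _ (hmem hw) _ (hmem hz)]
    show K (((a⁻¹ : ℝ) : ℂ) * Complex.arctan (conj (Complex.tan ((a : ℂ) * w))))
        (((a⁻¹ : ℝ) : ℂ) * Complex.arctan (Complex.tan ((a : ℂ) * z))) = K (conj w) z
    rw [← tan_mul_conj, inv_mul_arctan_tan_mul ha haε hw', inv_mul_arctan_tan_mul ha haε hz]

end Summit.QuantumFields.YangMills.Theorems.CurvatureBoostCovariance.BoostsInheritMirrors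

end
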